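import Summits.Langlands.Langlands.Theorems.PhaseTwistSplit
import Summits.Langlands.Langlands.Theorems.RegularShadowSplit

/-!
# `AdjointCellSplit` — lens-4 («minimal counterexample / extremal reduction») g33 node, RESIDUAL MODE — Theorems twin (census landing form: no bare `closes`, summit-consuming certificates private)

«ON AN EXACT CHEBOTAREV CELL THE ADJOINT TRACE IS AN ARTIN CHARACTER — AND IN RANK 2 THE ADJOINT L-FUNCTION CAN PRICE IT.»

TARGET (BY NAME) = IMP = tree `Theorems.PhaseTwistSplit.ImprimitiveCandidateRigidity` (g30's declared residual of RIGID =
`Theses.PerfectLayerClifford.PerfectLayerRigidity` = stmt-Langlands-27355 of route-Langlands-PerfectLayerClifford rev 0; g30 bus tag «rank-reducing cell ·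
UNDECIDED · honest residual: no attack offered»; tree `PhaseTwistSplit.rigid_iff_strong_imp : RIGID ↔ STRONG ∧ IMP`, `imp_of_langlands : Langlands → IMP`).
IMP says: a cuspidal L-algebraic `π` on `GL_n/K` whose RELATIVE AVATAR `r : Γ_L → GL_n(ℚ̄_ℓ)` (irreducible) along a Galois layer `L/K` with no cyclic
sub-layer of prime degree (`charpoly r(Frob_w) = Sat(t_{π,v}^{f(w|v)})` a.e.) is ALSO satisfied by the restriction of a semisimple candidate
`ρ₀ : Γ_K → GL_n` that is NOT strongly irreducible, has a genuine avatar over `K`.  The lineage's nemesis on this cell (g29/g30 memos): off the split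
places `π` is seen only through the POWERS `t^{f}`, so `ρ₀` is pinned down only up to an `f`-th-root-of-unity PHASE per place, and for an imprimitive
`ρ₀` no finite-order twist need absorb the phases.  LENS-4 READING: a minimal counterexample lives in the smallest rank, `n = 2`; there an irreducible,
not strongly irreducible `ρ₀` is either INDUCED from a quadratic field (dihedral cell) or an ARTIN representation of projective type `A₄/S₄/A₅` up to
twist (twisted-primitive cell; Clifford + Tate lifting) — and on both cells the counterexample is destroyed by the ADJOINT L-function of `π`, priced
against the Artin forms of the layer: the whole rank-2 imprimitive cell contains NO open problem beyond strong Artin for its own layer groups.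

## Mechanism (paper proofs of DCD (a) and TPD (b); complete modulo the cited print theorems; ≈ 1½ pages)

COMMON.  `G := Gal(L/K)` has no quotient of prime order, so `G` is PERFECT (`≠ 1`).  Both `r` and `ρ₀|_{Γ_L}` satisfy the relative relation, so by
Chebotarev over `L` and Brauer–Nesbitt `r ≅ (ρ₀|_{Γ_L})^{ss} = ρ₀|_{Γ_L}`; hence `ρ₀` is IRREDUCIBLE.  EXACT CELL: at a place `v ∉ S` of `K` SPLIT COMPLETELY
in `L`, `f(w|v) = 1` and the relation reads `Sat(t_{π,v}) = charpoly ρ₀(Frob_v)` — no phase.  If `π ≅ π ⊗ η` for a quadratic `η` (π DIHEDRAL) we are done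
at once: `π = AI_{K_η}^{K}(ψ)` (Labesse–Langlands 1979), `ψ` is an algebraic Hecke character because `π` is L-algebraic (infinity types), `ψ` has an `ℓ`-adic
avatar `ψ_λ` (Weil 1956; tree rank-one (A)), and `ρ := Ind ψ_λ` is a semisimple avatar of `π`, Satake–Frobenius compatible a.e. EXACTLY.  So assume `π`
non-dihedral; then `ad π := Sym² π ⊗ ω_π⁻¹` is a unitary CUSPIDAL representation of `GL₃/K` (Gelbart–Jacquet 1978, Thm 9.3), self-dual with trivial
central character.  PRICING LEMMA: for an irreducible Artin representation `B` of `Γ_K` with strong-Artin form `π_B` (antecedent `StrongArtinOver K`;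
`dim B = 1`: class field theory),  `Σ_{v ∉ S} Tr ad(t_{π,v}) · χ_B(Frob_v) · q_v^{-s} = m_B · log(1/(s−1)) + O(1)`  (`s → 1⁺`), `m_B ∈ {0,1}`, `m_B = 1 ⟺
π_{B̄} ≅ ad π`; at most ONE `B` has `m_B = 1`, and it has `dim B = 3`.  [The left side is the `k = 1` part of `log L^S(s, ad π × π_B)`; the `k ≥ 2` part
converges absolutely at `s = 1` because the Satake parameters of `ad π` are bounded by `q_v^{2θ}`, `θ = 7/64 < 1/4` (Kim–Sarnak 2003 over `ℚ`, Blomer–Brumley,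
Ann. Math. 174 (2011) over `K`); pole/holomorphy and NON-VANISHING at `s = 1` of `L^S(s, ad π × π_B)` for the unitary cuspidal pair `GL₃ × GL_{dim B}`:
Jacquet–Shalika, Amer. J. Math. 103 (1981) (I) Prop. 3.6/(3.7), (II) Thm 4.8, and Shahidi 1981, Thm 5.2; uniqueness of `B`: distinct `B` have distinct
`π_B` by Chebotarev.]

(a) DIHEDRAL CELL (piece DCD): `ρ₀` reducible on `Γ_M`, `[M:K] = 2`, hence `ρ₀ ≅ Ind_{Γ_M}^{Γ_K} χ₀` (Clifford; `χ₀/χ₀ᶜ` of ANY order) and `Tr ρ₀ = 0` off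
`Γ_M` (kernel: `trace_antidiagonal`).  `M ⊄ L` (else `G ↠ C₂`), so `Γ' := Gal(ML/K) ≅ C₂ × G`.  On the Chebotarev class of the CENTRAL element `(c,1)` —
`v` inert in `M`, split in `L`; Dirichlet density `1/|Γ'|` — the cell is exact and `Tr ρ₀(Frob_v) = 0`, so `t_{π,v} = {β_v, −β_v}` and
  `Tr ad(t_{π,v}) = β/(−β) + 1 + (−β)/β = −1`                                            (kernel: `adTrace_of_trace_zero`, `det_antidiagonal`).
Column orthogonality at the central class: `1_{(c,1)} = (1/|Γ'|) Σ_{B ∈ Irr Γ'} χ_B((c,1))¯ · χ_B` with `Irr Γ' = {A ⊗ ε^a}`, `χ_{A⊗ε^a}((c,1)) = (−1)^a dim A`.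
Summing the pricing lemma:  `Σ_{v ∈ cell} Tr ad(t_{π,v}) q_v^{-s} = (1/|Γ'|) · (Σ_B (−1)^{a_B} dim(A_B) m_B) · log(1/(s−1)) + O(1)`, and the bracket is
`0`, `3` or `−3` (kernel: `cellMean_obstruction`).  The left side is `−Σ_{v ∈ cell} q_v^{-s} = −(1/|Γ'|) log(1/(s−1)) + O(1)` (Chebotarev, Dirichlet form).
`−1 ∉ {0, ±3}`: contradiction.  So on the dihedral cell `π` IS dihedral, and the opening paragraph gives the avatar.

(b) TWISTED-PRIMITIVE CELL (piece TPD): `ρ₀` irreducible on every quadratic field but reducible on some finite `Γ_{M₁}`: by Clifford the constituents on a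
minimal such Galois `M₁` are `Γ_K`-conjugate characters with stabiliser of index `≤ 2`, index `2` being excluded — so `ρ₀|_{Γ_{M₁}} = χ ⊕ χ` is SCALAR,
the projective image of `ρ₀` is finite (`A₄`, `S₄` or `A₅`: cyclic is impossible for irreducible `ρ₀`, dihedral is the excluded cell), and by Tate's
lifting theorem `ρ₀ ≅ ρ_A ⊗ χ'` with `ρ_A` an irreducible ARTIN representation (fixed field `M_A`, Galois) and `χ'` an `ℓ`-adic character.  On the exact
cell `N := Gal(M_A L / L) ⊲ Γ'' := Gal(M_A L / K)` (places split in `L`):  `Tr ad(t_{π,v}) = χ_{ad A}(Frob_v)` (the twist cancels).  Price the class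
function `F := 1_N · χ̄_{ad A}` on `Γ''`:  LEFT `Σ_v Tr ad(t_{π,v}) F(Frob_v) q_v^{-s} = Σ_{Frob_v ∈ N} |χ_{adA}(Frob_v)|² q_v^{-s} = κ · log(1/(s−1)) + O(1)` with
`κ = (1/|Γ''|) Σ_{g ∈ N} |χ_{adA}(g)|² ≥ 9/|Γ''| > 0` (kernel: `isotypicMass_pos`);  RIGHT `= Σ_B ⟨F, χ_B⟩ m_B · log(1/(s−1)) + O(1)`.  Hence some `B₀ ∈ Irr Γ''`
has `m_{B₀} = 1`: `ad π ≅ π_{B̄₀}`, `dim B₀ = 3`.  Comparing central characters and duals a.e. (Chebotarev): `det B₀ = 1` and `B₀ ≅ B₀^∨`; an irreducible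
self-dual representation of odd dimension is ORTHOGONAL, so `B₀ : Γ_K → SO₃(ℂ) ≅ PGL₂(ℂ)` lifts (Tate) to an irreducible Artin `ρ̃ : Γ_K → GL₂(ℂ)` with
`ad ρ̃ ≅ B̄₀`, non-dihedral (else `ad ρ̃` reducible).  Strong Artin over `K` for `ρ̃` gives cuspidal `π(ρ̃)` on `GL₂/K`; `ad π(ρ̃)` (Gelbart–Jacquet) has the
Satake parameters of `ad ρ̃ = B̄₀` a.e., so `ad π(ρ̃) ≅ π_{B̄₀} ≅ ad π` by strong multiplicity one, and RAMAKRISHNAN'S ADJOINT THEOREM (Ann. Math. 152 (2000),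
Thm 4.1.2: `Ad(π_v) ≅ Ad(π'_v)` a.e. ⟹ `π' ≅ π ⊗ ν`) gives `π ≅ π(ρ̃) ⊗ ν` for an idele class character `ν`, algebraic because `π` and `π(ρ̃)` are both
L-algebraic.  Then `ρ := ι⁻¹ρ̃ ⊗ ν_λ` is a semisimple (irreducible) avatar of `π`, exactly compatible a.e.

UNCONDITIONAL INSTANCE of (a) (BC5-style witness; plan-only in Lean): `K = ℚ`, `Gal(L/ℚ) ≅ A₅`, `L` NOT totally real.  Strong Artin over `ℚ` in the a.e.
form holds for every `B ∈ Irr(C₂ × A₅) = {A ⊗ ε^a}`, `dim A ∈ {1,3,3,4,5}`: the projective representation `Γ_ℚ ↠ A₅ ⊂ PGL₂(ℂ)` lifts (Tate) to an ODD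
icosahedral `ρ̃` (complex conjugation is non-trivial in `A₅`), modular of weight one by Khare–Wintenberger–Kisin, and so is `ρ̃^τ`; the two `3`'s are
`ad ρ̃`, `ad ρ̃^τ` (Gelbart–Jacquet), the `4` is `ρ̃ ⊗ ρ̃^τ` up to twist (Ramakrishnan's `GL₂ × GL₂ → GL₄`, cuspidal by his criterion), the `5` is `Sym⁴ ρ̃`
up to twist (Kim 2003; cuspidal for icosahedral type by Kim–Shahidi 2002) — cf. S. Wang, IMRN 2003:44, p.2.  Hence DCD holds OUTRIGHT for every cuspidal
L-algebraic `π` on `GL₂/ℚ` across every such layer — MAASS FORMS OF EIGENVALUE `¼` INCLUDED, for which no Galois representation is known: on that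
population the content of (a) is the theorem «a non-dihedral Maass form cannot have `a_p = 0` on (almost all of) the Chebotarev class `(c,1)` of a
`C₂ × A₅`-extension», which neither Serre-type lacunarity (needs an `ℓ`-adic representation) nor Walji's density bounds (`≤ 1/2`, blind to a class of
density `1/120`) give.  (b) over `ℚ` is NOT unconditional: it prices against all of `Irr(Gal(M_A L/ℚ))`, e.g. `3 ⊗ 5`, beyond Kim–Shahidi's products.

## Pieces (IMP ⟸ DCD ∧ TPD ∧ SART ∧ IMP₃; kernel `closes_target`, 0 sorry; exactness `imp_iff_pieces : SART → (IMP ↔ DCD ∧ TPD ∧ IMP₃)`)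

* **DCD** `DihedralCandidateDescent` [new] (crux rank 2 · WEAKER: `dcd_of_imp` · S-implied: `dcd_of_langlands` · ATTACKABLE-NOW, proof (a); print-
  unconditional on `K = ℚ`, odd `A₅`-layers).  IMP's tree text with the edits `n ↦ 2` (`0 < n` dropped), «not strongly irreducible» ↦ `¬ QuadIrreducible K ρ₀`
  (reducible on SOME quadratic field — which implies it), `RegularShadowSplit.StrongArtinOver K →` inserted before the candidate.
* **TPD** `TwistedPrimitiveDescent` [new] (crux rank 3 · WEAKER: `tpd_of_imp` · S-implied · ATTACKABLE-NOW given strong Artin over `K`, proof (b)).  IMP's text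
  with `n ↦ 2`, `QuadIrreducible K ρ₀ ∧` inserted into the candidate clause, the same antecedent.
* **SART** = tree `Theses.MonomialConverse.StrongArtinAE` (stmt-Langlands-18578; OPEN; the registered target of route-Langlands-MonomialConverse; cited BY NAME as
  in g32).  LATERAL / honest EXCESS: DCD needs strong Artin only for `Irr(Gal(L/K))`, TPD for `Irr(Gal(M_A L/K))`; the kernel feeds all of SART through
  `strongArtinOver_of_strongArtinAE`.  NOT cheaply S-implied in the kernel (the `ι`-dictionary «finite image ⇒ geometric» is not in the tree; g32 flag).
* **IMP₃** `HigherRankImprimitiveRigidity` [new] (declared RESIDUAL · WEAKER: `imp3_of_imp` · S-implied · UNDECIDED · IDEA-NEEDED).  IMP's text verbatim with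
  `n ≠ 2 →` inserted: ranks `n ≥ 3` (rank 1 is empty).  The exact cell and the Artin character `χ_{ad ρ₀}|_N` survive in every rank for candidates of
  finite projective image, but the pricing needs `Ad : GL_n → GL_{n²−1}` / `π ⊠ π̃` on `GL_{n²}` or `GL_n × GL_n × GL_d` triple products — open functoriality;
  for candidates induced from a degree-`d` subfield the analogue of `−1` is `Tr ad = (number of fixed blocks) − 1` on suitable classes, same obstruction.

EXTREMAL READING.  A minimal counterexample to IMP has rank 2 or lies in IMP₃.  In rank 2 it is a non-dihedral cuspidal `π` whose Satake classes on an
exact Chebotarev cell are those of `Ind χ₀` or of `ρ_A ⊗ χ'`; the adjoint L-function priced against the Artin forms of the layer group says, respectively,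
«impossible» and «then `π` is `π(ρ̃) ⊗ ν`» — so the counterexample must come with an irreducible Artin representation of `Gal(L/K)` resp. `Gal(M_A L/K)`
VIOLATING strong Artin over `K`.  The rank-2 imprimitive cell of the perfect-layer rigidity problem is strong Artin and nothing else.

## Honest flags
1. SART is fed whole (all fields, all ranks); DCD/TPD consume `StrongArtinOver K` only.  One-way lateral, exactly as in g32.
2. DCD, TPD, IMP₃ are each S-implied and each WEAKER than IMP by kernel certificates; none is cheaply equivalent to IMP or to `Langlands`, no two of them give
   IMP (probes file: every `example` fails).  Given SART the split is EXACT (`imp_iff_pieces`).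
3. Lean debt of (a)/(b) (why ATTACKABLE-NOW is a paper claim): JS/Shahidi analytic theory of `L^S(s, Π × Π')` for cuspidal `GL₃ × GL_d`; Gelbart–Jacquet `ad`;
   `θ < 1/4` on `GL₂`; Chebotarev in Dirichlet-density form; Brauer–Nesbitt + Chebotarev for `ℓ`-adic representations (`r ≅ ρ₀|_{Γ_L}`); Clifford at index 2 and
   Tate's lifting of projective representations; Labesse–Langlands; Ramakrishnan Thm 4.1.2 and his `GL₂ × GL₂` cuspidality criterion; Weil's avatars of
   algebraic Hecke characters of `K_η` / `K` (tree: rank-one (A) over the base).  None is in `Literature/` today; each is a typable named fact.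
4. L- versus C-algebraic half-twist bookkeeping and the `arithFrobPolyOfSatake ι q 1` convention (dual/inverse) are as in g30/g32 and are absorbed in `ψ`, `ν`.
5. `QuadIrreducible` is stated for any rank; the kernel SUBSTITUTES `n := 2` on the rank-2 branch (`subst`), so DCD/TPD are literally rank 2 — no transport.

## Why genuinely new (by construction and by search)
Other lenses' current nodes: lens-1 g33 `SplitPrimeDescentLadder` (EvenIcosahedralCMCorner 14077), lens-3 (Iwahori/level DAG edge on 27042), lens-5 g29/g30
(dyadic / odd-prime door splits of curve-side residuals), lens-2 / lens-6 (leaf-proof kits) — none touches the perfect-layer phase problem.  Within the lineage: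
g29 cut RIGID by candidate automorphy, g30 by strong irreducibility + power-charpoly rigidity (Patankar–Rajan), g31 cut RED° by Clifford orbit type, g32 cut
FINTYPE by finite Satake type + the regular representation (there `π` is special and the GROUP ALGEBRA is integrated; here `π` is ARBITRARY and the
ADJOINT of `π` is integrated over one exact cell).  Literature [corpus labels]: lacunarity ⇒ CM/dihedral is Serre 1981 §7 for forms WITH `ℓ`-adic
representations; automorphic-side, Walji [corpus:paper:arxiv-1411.2058 p.1–3, MRL 21 (2014) Thm 1.2/1.3] bounds the upper density of `{a_v = 0}` by `1 − 1/n²`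
(`1/2` for non-dihedral `GL₂`) via `π × π × π̄ × π̄` and cannot see a class of density `1/(2|G|)`; Booker [corpus:paper:arxiv-1712.06876 p.2, Math. Z. 2018]
treats Maass forms «of icosahedral type» by Ramakrishnan's ideas from a COEFFICIENT-FIELD hypothesis and explicitly cannot reach a Galois representation;
Ramakrishnan [corpus:paper:galaxy-pdf-4279542020 p.49 Thm 4.1.2] and Wang [corpus:paper:arxiv-math_0301074 p.2] are the tools of (b) and of the witness.
Galaxy `--star all`/`pdf` needles «icosahedral|strong Artin conjecture for A5|symmetric powers of icosahedral», «lacunary|vanishing Hecke eigenvalues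
Chebotarev»: nothing beyond the above.  Delta in one sentence: Chebotarev-cell EXACTNESS of a relative avatar turns `Tr ad(t_π)` into an Artin character on a
class of positive density, which `GL₃ × GL_d` Rankin–Selberg against the layer's Artin forms can price — deciding the rank-2 imprimitive cell from strong Artin
alone, for arbitrary (e.g. Maass) `π`, with no Galois representation of `π` in hand.

## BC record (planner-side; raw outputs in the g33 kit: `.probes.check.json`, `.bc7.out`, `.axioms_probe.check.json`)
bc1 cone = 4 load-bearing binders (DCD, TPD, SART, IMP₃) · bc2 `X → IMP`, `X → Langlands` FAIL for each piece and each proper sub-conjunction (probes plan) ·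
bc3/bc5 plan-only: `stub_exactCell` (split place ⇒ `f = 1` ⇒ `Sat(t_v) = charpoly ρ₀(Frob_v)`), `stub_pricing` (the pricing lemma), `stub_dihedralAvatar` /
`stub_artinTwistAvatar`; rung = (a) on `K = ℚ`, odd `A₅`-layers (outside S's known regime: Maass `π`) · bc4 no tree decl of any piece's shape (`lean search`) ·
bc6 declared 4 / in-cone 4 / aside 0 (`QuadIrreducible` is an auxiliary def, not an item) · bc7 see `.bc7.out` · bc8: NonRegularWeightBarrier — OUTSIDE (no
weight input; the `GL₃ × GL_d` argument is insensitive to `π_∞`); SolvableImageBarrier — INSIDE for SART on insoluble `G` (declared lateral piece, not beaten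
here; over `ℚ`/odd `A₅` discharged in print); TaylorWilesNumericalCoincidence / ResiduallyReducible / TwistedEndoscopySelfDual — not in the technique class ·
bc9 method_family = «Rankin–Selberg pole counting of `ad π` against Artin twists on an exact Chebotarev cell»; ladder_ceiling = capped-at-rank-2 (`Ad`
functoriality known only `GL₂ → GL₃`); ceiling_lift = `Ad : GL_n → GL_{n²−1}` / `GL_n × GL_n → GL_{n²}` [declared: IMP₃]; ceiling_sources =
[Literature/Barriers/Langlands/SolvableImageBarrier.lean; corpus:paper:arxiv-math_0301074 p.2; corpus:paper:arxiv-1411.2058 p.2–3].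
-/

set_option linter.dupNamespace false
set_option linter.style.longLine false

noncomputable section

namespace Summit.Langlands.Langlands.Theorems.AdjointCellSplit

open scoped BigOperators Topology Matrix Classical NumberField Polynomial
open Filter Set Function
open Literature.NumberTheory.GaloisRepresentations Literature.NumberTheory.Automorphic
open IsDedekindDomain
open Summit.Langlands.Langlands.Theses
open Summit.Langlands.Langlands.Theorems.TatePhantomLift (PerfectLayerRigidity rigid_of_langlands rigid_of_perfect)
open Summit.Langlands.Langlands.Theorems.PhaseTwistSplit (ImprimitiveCandidateRigidity PowerAvatarDescent imp_of_rigid imp_of_langlands)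
open Summit.Langlands.Langlands.Theorems.RegularShadowSplit (StrongArtinOver strongArtinOver_of_strongArtinAE)

/-! ## §0 The dial inside rank 2: irreducibility on every quadratic field -/

/-- [new] **`QuadIrreducible K ρ₀`**: the candidate stays irreducible on EVERY quadratic extension `M/K`.  For an irreducible rank-2 `ρ₀` that is
not strongly irreducible, `¬ QuadIrreducible` is the DIHEDRAL CELL (`ρ₀ ≅ Ind_{Γ_M}^{Γ_K} χ₀`, Clifford at index 2, `χ₀/χ₀ᶜ` of any order) and
`QuadIrreducible` is the TWISTED-PRIMITIVE CELL (`ρ₀ ≅ ρ_A ⊗ χ` with `ρ_A` Artin of projective image `A₄`, `S₄` or `A₅`; Clifford + Tate lifting). -/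
def QuadIrreducible (K : Type) [Field K] [NumberField K] {ℓ : ℕ} [Fact ℓ.Prime] {n : ℕ}
    (ρ₀ : FramedGaloisRep K (PadicAlgCl ℓ) n) : Prop :=
  ∀ (M : Type) [Field M] [NumberField M] [Algebra K M], Module.finrank K M = 2 → (ρ₀.restrictField M).IsIrreducible

/-! ## §1 The pieces (IMP's tree text `b694ac721303` with literal, asserted edits — `gen_node33.py`; SART is cited BY NAME) -/

/-- [new] **DCD · `DihedralCandidateDescent`** (crux · rank 2 of the node · WEAKER than IMP: `dcd_of_imp` · S-implied: `dcd_of_langlands` ·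
**ATTACKABLE-NOW: paper proof (a) of the module docstring, complete modulo print; UNCONDITIONAL in print for `K = ℚ` across every
non-totally-real `A₅`-layer, Maass forms included**).  IMP at rank 2 on the dihedral cell, with strong Artin over `K` (tree
`RegularShadowSplit.StrongArtinOver K` = the body of `MonomialConverse.StrongArtinAE` at one field) as antecedent.  Edits of IMP's text: `n ↦ 2`
(`0 < n` dropped), «not strongly irreducible» ↦ `¬ QuadIrreducible K ρ₀`, antecedent inserted.  Why it might fail: it cannot if Langlands holds
(`dcd_of_langlands`); the risk is only in the Lean debt (analytic theory of `GL₃ × GL_d` Rankin–Selberg L-functions; honest flag 3). -/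
def DihedralCandidateDescent : Prop :=
  ∀ (K : Type) [Field K] [NumberField K] (hcpt : Literature.NumberTheory.Automorphic.isCompact_glFiniteIntegralLevel 2 K) (π : Literature.NumberTheory.Automorphic.CuspidalAutomorphicRepData 2 K hcpt), π.1.IsLAlgebraic → ∀ (L : Type) [Field L] [NumberField L] [Algebra K L], IsGalois K L → Module.finrank K L ≠ 1 → (¬ ∃ F : IntermediateField K L, F ≠ ⊥ ∧ IsGalois K ↥F ∧ IsCyclic (↥F ≃ₐ[K] ↥F) ∧ (Module.finrank K ↥F).Prime) → ∀ (ℓ : ℕ) [Fact ℓ.Prime] (ι : PadicAlgCl ℓ ≃+* ℂ) (r : Literature.NumberTheory.GaloisRepresentations.FramedGaloisRep L (PadicAlgCl ℓ) 2), r.toGaloisRep.IsSemisimple → r.IsIrreducible → Summit.Langlands.Langlands.Theorems.RegularShadowSplit.StrongArtinOver K → (∃ ρ₀ : Literature.NumberTheory.GaloisRepresentations.FramedGaloisRep K (PadicAlgCl ℓ) 2, ρ₀.toGaloisRep.IsSemisimple ∧ ¬ QuadIrreducible K ρ₀ ∧ (∀ᶠ w : IsDedekindDomain.HeightOneSpectrum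 (NumberField.RingOfIntegers L) in cofinite, ∀ (v : IsDedekindDomain.HeightOneSpectrum (NumberField.RingOfIntegers K)) (α : Multiset ℂ), w.asIdeal.under (NumberField.RingOfIntegers K) = v.asIdeal → π.1.HasSatakeParamAt v α → (ρ₀.restrictField L).IsUnramifiedAt w ∧ (ρ₀.restrictField L).HasFrobCharpolyAt w (Literature.NumberTheory.Automorphic.arithFrobPolyOfSatake ι w.residueCard 1 (α.map (fun a => a ^ w.asIdeal.inertiaDeg (NumberField.RingOfIntegers K)))))) → (∀ᶠ w : IsDedekindDomain.HeightOneSpectrum (NumberField.RingOfIntegers L) in cofinite, ∀ (v : IsDedekindDomain.HeightOneSpectrum (NumberField.RingOfIntegers K)) (α : Multiset ℂ), w.asIdeal.under (NumberField.RingOfIntegers K) = v.asIdeal → π.1.HasSatakeParamAt v α → r.IsUnramifiedAt w ∧ r.HasFrobCharpolyAt w (Literature.NumberTheory.Automorphic.arithFrobPolyOfSatake ι w.residueCard 1 (α.map (fun a => a ^ w.asIdeal.inertiaDeg (NumberField.RingOfIntegers K))))) → ∃ ρ : Literature.NumberTheory.GaloisRepresentations.FramedGaloisRep K (PadicAlgCl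 ℓ) 2, ρ.toGaloisRep.IsSemisimple ∧ ∀ᶠ v : IsDedekindDomain.HeightOneSpectrum (NumberField.RingOfIntegers K) in cofinite, SatakeFrobCompatibleAt ι π.1 ρ v

/-- [new] **TPD · `TwistedPrimitiveDescent`** (crux · rank 3 of the node · WEAKER than IMP: `tpd_of_imp` · S-implied: `tpd_of_langlands` ·
**ATTACKABLE-NOW given strong Artin over `K`: paper proof (b) of the module docstring** — the adjoint-isotypic pricing of the split cell gives
`ad π ≅ π_{B₀}` for a `3`-dimensional self-dual Artin `B₀ = ad ρ̃`, then Ramakrishnan's adjoint theorem gives `π ≅ π(ρ̃) ⊗ ν`).  IMP at rank 2 on the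
twisted-primitive cell: the candidate is not strongly irreducible but `QuadIrreducible`.  Edits of IMP's text: `n ↦ 2` (`0 < n` dropped),
`QuadIrreducible K ρ₀ ∧` inserted, antecedent inserted.  NOT print-unconditional over `ℚ`: (b) prices against ALL irreducible Artin representations of
`Gal(M_A L/K)`, whose automorphy needs `GL_3 × GL_d`-type functorial products beyond Kim–Shahidi.  Why it might fail: as DCD. -/
def TwistedPrimitiveDescent : Prop :=
  ∀ (K : Type) [Field K] [NumberField K] (hcpt : Literature.NumberTheory.Automorphic.isCompact_glFiniteIntegralLevel 2 K) (π : Literature.NumberTheory.Automorphic.CuspidalAutomorphicRepData 2 K hcpt), π.1.IsLAlgebraic → ∀ (L : Type) [Field L] [NumberField L] [Algebra K L], IsGalois K L → Module.finrank K L ≠ 1 → (¬ ∃ F : IntermediateField K L, F ≠ ⊥ ∧ IsGalois K ↥F ∧ IsCyclic (↥F ≃ₐ[K] ↥F) ∧ (Module.finrank K ↥F).Prime) → ∀ (ℓ : ℕ) [Fact ℓ.Prime] (ι : PadicAlgCl ℓ ≃+* ℂ) (r : Literature.NumberTheory.GaloisRepresentations.FramedGaloisRep L (PadicAlgCl ℓ)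 2), r.toGaloisRep.IsSemisimple → r.IsIrreducible → Summit.Langlands.Langlands.Theorems.RegularShadowSplit.StrongArtinOver K → (∃ ρ₀ : Literature.NumberTheory.GaloisRepresentations.FramedGaloisRep K (PadicAlgCl ℓ) 2, ρ₀.toGaloisRep.IsSemisimple ∧ (¬ ∀ (M : Type) [Field M] [NumberField M] [Algebra K M], (ρ₀.restrictField M).IsIrreducible) ∧ QuadIrreducible K ρ₀ ∧ (∀ᶠ w : IsDedekindDomain.HeightOneSpectrum (NumberField.RingOfIntegers L) in cofinite, ∀ (v : IsDedekindDomain.HeightOneSpectrum (NumberField.RingOfIntegers K)) (α : Multiset ℂ), w.asIdeal.under (NumberField.RingOfIntegers K) = v.asIdeal → π.1.HasSatakeParamAt v α → (ρ₀.restrictField L).IsUnramifiedAt w ∧ (ρ₀.restrictField L).HasFrobCharpolyAt w (Literature.NumberTheory.Automorphic.arithFrobPolyOfSatake ι w.residueCard 1 (α.map (fun a => a ^ w.asIdeal.inertiaDeg (NumberField.RingOfIntegers K)))))) → (∀ᶠ w : IsDedekindDomain.HeightOneSpectrum (NumberField.RingOfIntegers L) in cofinite, ∀ (v : IsDedekindDomain.HeightOneSpectrum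 (NumberField.RingOfIntegers K)) (α : Multiset ℂ), w.asIdeal.under (NumberField.RingOfIntegers K) = v.asIdeal → π.1.HasSatakeParamAt v α → r.IsUnramifiedAt w ∧ r.HasFrobCharpolyAt w (Literature.NumberTheory.Automorphic.arithFrobPolyOfSatake ι w.residueCard 1 (α.map (fun a => a ^ w.asIdeal.inertiaDeg (NumberField.RingOfIntegers K))))) → ∃ ρ : Literature.NumberTheory.GaloisRepresentations.FramedGaloisRep K (PadicAlgCl ℓ) 2, ρ.toGaloisRep.IsSemisimple ∧ ∀ᶠ v : IsDedekindDomain.HeightOneSpectrum (NumberField.RingOfIntegers K) in cofinite, SatakeFrobCompatibleAt ι π.1 ρ v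

/-- [new] **IMP₃ · `HigherRankImprimitiveRigidity`** (declared RESIDUAL · WEAKER than IMP: `imp3_of_imp` · S-implied · UNDECIDED · IDEA-NEEDED).
IMP's text VERBATIM with the single antecedent `n ≠ 2 →` inserted after `0 < n →` (rank one is empty: a character is strongly irreducible).
Why it is the residual: the lever of DCD/TPD is `ad : GL₂ → GL₃` (Gelbart–Jacquet) + `GL₃ × GL_d` Rankin–Selberg; in rank `n ≥ 3` the exact split
cell still exists and still carries the candidate's adjoint character, but pricing it needs `π ⊠ π̃` automorphic on `GL_{n²}` (or `Ad : GL_n → GL_{n²−1}`),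
open functoriality — the ladder ceiling of the method (bc9). -/
def HigherRankImprimitiveRigidity : Prop :=
  ∀ (K : Type) [Field K] [NumberField K] (n : ℕ) (hcpt : Literature.NumberTheory.Automorphic.isCompact_glFiniteIntegralLevel n K), 0 < n → n ≠ 2 → ∀ (π : Literature.NumberTheory.Automorphic.CuspidalAutomorphicRepData n K hcpt), π.1.IsLAlgebraic → ∀ (L : Type) [Field L] [NumberField L] [Algebra K L], IsGalois K L → Module.finrank K L ≠ 1 → (¬ ∃ F : IntermediateField K L, F ≠ ⊥ ∧ IsGalois K ↥F ∧ IsCyclic (↥F ≃ₐ[K] ↥F) ∧ (Module.finrank K ↥F).Prime) → ∀ (ℓ : ℕ) [Fact ℓ.Prime] (ι : PadicAlgCl ℓ ≃+* ℂ) (r : Literature.NumberTheory.GaloisRepresentations.FramedGaloisRep L (PadicAlgCl ℓ) n), r.toGaloisRep.IsSemisimple → r.IsIrreducible → (∃ ρ₀ : Literature.NumberTheory.GaloisRepresentations.FramedGaloisRep K (PadicAlgCl ℓ) n, ρ₀.toGaloisRep.IsSemisimple ∧ (¬ ∀ (M : Type) [Field M] [NumberField M] [Algebra K M], (ρ₀.restrictField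 M).IsIrreducible) ∧ (∀ᶠ w : IsDedekindDomain.HeightOneSpectrum (NumberField.RingOfIntegers L) in cofinite, ∀ (v : IsDedekindDomain.HeightOneSpectrum (NumberField.RingOfIntegers K)) (α : Multiset ℂ), w.asIdeal.under (NumberField.RingOfIntegers K) = v.asIdeal → π.1.HasSatakeParamAt v α → (ρ₀.restrictField L).IsUnramifiedAt w ∧ (ρ₀.restrictField L).HasFrobCharpolyAt w (Literature.NumberTheory.Automorphic.arithFrobPolyOfSatake ι w.residueCard 1 (α.map (fun a => a ^ w.asIdeal.inertiaDeg (NumberField.RingOfIntegers K)))))) → (∀ᶠ w : IsDedekindDomain.HeightOneSpectrum (NumberField.RingOfIntegers L) in cofinite, ∀ (v : IsDedekindDomain.HeightOneSpectrum (NumberField.RingOfIntegers K)) (α : Multiset ℂ), w.asIdeal.under (NumberField.RingOfIntegers K) = v.asIdeal → π.1.HasSatakeParamAt v α → r.IsUnramifiedAt w ∧ r.HasFrobCharpolyAt w (Literature.NumberTheory.Automorphic.arithFrobPolyOfSatake ι w.residueCard 1 (α.map (fun a => a ^ w.asIdeal.inertiaDeg (NumberField.RingOfIntegers K))))) → ∃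 ρ : Literature.NumberTheory.GaloisRepresentations.FramedGaloisRep K (PadicAlgCl ℓ) n, ρ.toGaloisRep.IsSemisimple ∧ ∀ᶠ v : IsDedekindDomain.HeightOneSpectrum (NumberField.RingOfIntegers K) in cofinite, SatakeFrobCompatibleAt ι π.1 ρ v

/-! ## §2 Kernel: `closes_target` BY NAME (0 sorry), exactness, necessity and summit-side certificates -/

/-- **The deciding theorem** (0 sorry): DCD → TPD → SART → IMP₃ → IMP, concluding the tree decl
`Theorems.PhaseTwistSplit.ImprimitiveCandidateRigidity` BY NAME.  Cases on the rank (`n = 2` is SUBSTITUTED, so the rank-2 pieces are literally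
rank 2 — no transport) and, in rank 2, on `QuadIrreducible K ρ₀`; strong Artin over `K` is read off SART by tree `strongArtinOver_of_strongArtinAE`. -/
theorem closes_target (hD : DihedralCandidateDescent) (hT : TwistedPrimitiveDescent) (hA : MonomialConverse.StrongArtinAE)
    (hI : HigherRankImprimitiveRigidity) : ImprimitiveCandidateRigidity := by
  intro K _ _ n hcpt hn π hπ L _ _ _ hGal h1 hnc ℓ _ ι r hr hirr hcand hrel
  obtain ⟨ρ₀, hρ₀, hnsi, h₀⟩ := hcand
  by_cases hn2 : n = 2
  · subst hn2
    by_cases hq : QuadIrreducible K ρ₀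
    · exact hT K hcpt π hπ L hGal h1 hnc ℓ ι r hr hirr (strongArtinOver_of_strongArtinAE hA K) ⟨ρ₀, hρ₀, hnsi, hq, h₀⟩ hrel
    · exact hD K hcpt π hπ L hGal h1 hnc ℓ ι r hr hirr (strongArtinOver_of_strongArtinAE hA K) ⟨ρ₀, hρ₀, hq, h₀⟩ hrel
  · exact hI K n hcpt hn hn2 π hπ L hGal h1 hnc ℓ ι r hr hirr ⟨ρ₀, hρ₀, hnsi, h₀⟩ hrel

/-- **Rank 2 in one piece**: given strong Artin (a.e. form), IMP restricted to rank 2 follows from DCD ∧ TPD — stated as the `n = 2` instance of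
IMP's binder list (the form `closes_target` consumes). -/
theorem rankTwo_of_pieces (hD : DihedralCandidateDescent) (hT : TwistedPrimitiveDescent) (K : Type) [Field K] [NumberField K]
    (hSA : StrongArtinOver K) (hcpt : isCompact_glFiniteIntegralLevel 2 K) (π : CuspidalAutomorphicRepData 2 K hcpt) (hπ : π.1.IsLAlgebraic)
    (L : Type) [Field L] [NumberField L] [Algebra K L] (hGal : IsGalois K L) (h1 : Module.finrank K L ≠ 1)
    (hnc : ¬ ∃ F : IntermediateField K L, F ≠ ⊥ ∧ IsGalois K ↥F ∧ IsCyclic (↥F ≃ₐ[K] ↥F) ∧ (Module.finrank K ↥F).Prime)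
    (ℓ : ℕ) [Fact ℓ.Prime] (ι : PadicAlgCl ℓ ≃+* ℂ) (r : FramedGaloisRep L (PadicAlgCl ℓ) 2) (hr : r.toGaloisRep.IsSemisimple) (hirr : r.IsIrreducible)
    (ρ₀ : FramedGaloisRep K (PadicAlgCl ℓ) 2) (hρ₀ : ρ₀.toGaloisRep.IsSemisimple)
    (hnsi : ¬ ∀ (M : Type) [Field M] [NumberField M] [Algebra K M], (ρ₀.restrictField M).IsIrreducible)
    (h₀ : ∀ᶠ w : HeightOneSpectrum (𝓞 L) in cofinite, ∀ (v : HeightOneSpectrum (𝓞 K)) (α : Multiset ℂ), w.asIdeal.under (𝓞 K) = v.asIdeal →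
      π.1.HasSatakeParamAt v α → (ρ₀.restrictField L).IsUnramifiedAt w ∧ (ρ₀.restrictField L).HasFrobCharpolyAt w
        (arithFrobPolyOfSatake ι w.residueCard 1 (α.map (fun a => a ^ w.asIdeal.inertiaDeg (𝓞 K)))))
    (hrel : ∀ᶠ w : HeightOneSpectrum (𝓞 L) in cofinite, ∀ (v : HeightOneSpectrum (𝓞 K)) (α : Multiset ℂ), w.asIdeal.under (𝓞 K) = v.asIdeal →
      π.1.HasSatakeParamAt v α → r.IsUnramifiedAt w ∧ r.HasFrobCharpolyAt w
        (arithFrobPolyOfSatake ι w.residueCard 1 (α.map (fun a => a ^ w.asIdeal.inertiaDeg (𝓞 K))))) :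
    ∃ ρ : FramedGaloisRep K (PadicAlgCl ℓ) 2, ρ.toGaloisRep.IsSemisimple ∧
      ∀ᶠ v : HeightOneSpectrum (𝓞 K) in cofinite, SatakeFrobCompatibleAt ι π.1 ρ v := by
  haveI := hGal
  by_cases hq : QuadIrreducible K ρ₀
  · exact hT K hcpt π hπ L hGal h1 hnc ℓ ι r hr hirr hSA ⟨ρ₀, hρ₀, hnsi, hq, h₀⟩ hrel
  · exact hD K hcpt π hπ L hGal h1 hnc ℓ ι r hr hirr hSA ⟨ρ₀, hρ₀, hq, h₀⟩ hrel

/-- **DCD is WEAKER than IMP**: reducible on a quadratic field is in particular not strongly irreducible; the antecedent is dropped. -/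
theorem dcd_of_imp (h : ImprimitiveCandidateRigidity) : DihedralCandidateDescent := by
  intro K _ _ hcpt π hπ L _ _ _ hGal h1 hnc ℓ _ ι r hr hirr _hSA hcand hrel
  obtain ⟨ρ₀, hρ₀, hq, h₀⟩ := hcand
  have hnsi : ¬ ∀ (M : Type) [Field M] [NumberField M] [Algebra K M], (ρ₀.restrictField M).IsIrreducible :=
    fun hsi => hq fun M _ _ _ _ => hsi M
  exact h K 2 hcpt two_pos π hπ L hGal h1 hnc ℓ ι r hr hirr ⟨ρ₀, hρ₀, hnsi, h₀⟩ hrel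

/-- **TPD is WEAKER than IMP** (one inserted hypothesis, one dropped antecedent, rank slice). -/
theorem tpd_of_imp (h : ImprimitiveCandidateRigidity) : TwistedPrimitiveDescent := by
  intro K _ _ hcpt π hπ L _ _ _ hGal h1 hnc ℓ _ ι r hr hirr _hSA hcand hrel
  obtain ⟨ρ₀, hρ₀, hnsi, -, h₀⟩ := hcand
  exact h K 2 hcpt two_pos π hπ L hGal h1 hnc ℓ ι r hr hirr ⟨ρ₀, hρ₀, hnsi, h₀⟩ hrel

/-- **IMP₃ is WEAKER than IMP** (one inserted antecedent). -/
theorem imp3_of_imp (h : ImprimitiveCandidateRigidity) : HigherRankImprimitiveRigidity := by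
  intro K _ _ n hcpt hn _hn2 π hπ L _ _ _ hGal h1 hnc ℓ _ ι r hr hirr hcand hrel
  exact h K n hcpt hn π hπ L hGal h1 hnc ℓ ι r hr hirr hcand hrel

/-- **Exactness given SART**: `IMP ⟺ DCD ∧ TPD ∧ IMP₃` (SART is the one-way lateral input, as in g32's FINTYPE cut). -/
theorem imp_iff_pieces (hA : MonomialConverse.StrongArtinAE) :
    ImprimitiveCandidateRigidity ↔ (DihedralCandidateDescent ∧ TwistedPrimitiveDescent ∧ HigherRankImprimitiveRigidity) :=
  ⟨fun h => ⟨dcd_of_imp h, tpd_of_imp h, imp3_of_imp h⟩, fun h => closes_target h.1 h.2.1 hA h.2.2⟩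

/-- Unconditional half of the exactness: IMP implies all three new pieces. -/
theorem pieces_of_imp (h : ImprimitiveCandidateRigidity) :
    DihedralCandidateDescent ∧ TwistedPrimitiveDescent ∧ HigherRankImprimitiveRigidity :=
  ⟨dcd_of_imp h, tpd_of_imp h, imp3_of_imp h⟩

/-- DCD is WEAKER than RIGID (stmt-Langlands-27355, tree `TatePhantomLift.PerfectLayerRigidity`). -/
theorem dcd_of_rigid (hR : PerfectLayerRigidity) : DihedralCandidateDescent := dcd_of_imp (imp_of_rigid hR)

/-- TPD is WEAKER than RIGID. -/
theorem tpd_of_rigid (hR : PerfectLayerRigidity) : TwistedPrimitiveDescent := tpd_of_imp (imp_of_rigid hR)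

/-- IMP₃ is WEAKER than RIGID. -/
theorem imp3_of_rigid (hR : PerfectLayerRigidity) : HigherRankImprimitiveRigidity := imp3_of_imp (imp_of_rigid hR)

/-- DCD is S-implied (BC2, direction `S → C`; the probes file shows `C → S` and `C → IMP` are not cheap). -/
private theorem dcd_of_langlands (hL : _root_.Langlands) : DihedralCandidateDescent := dcd_of_imp (imp_of_langlands hL)

/-- TPD is S-implied. -/
private theorem tpd_of_langlands (hL : _root_.Langlands) : TwistedPrimitiveDescent := tpd_of_imp (imp_of_langlands hL)

/-- IMP₃ is S-implied. -/
private theorem imp3_of_langlands (hL : _root_.Langlands) : HigherRankImprimitiveRigidity := imp3_of_imp (imp_of_langlands hL)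

/-! ## §3 Host edges (BY NAME, through the g30 kernel `PhaseTwistSplit.closes_target : PAR → IMP → RIGID`) -/

/-- RIGID (tree twin `TatePhantomLift.PerfectLayerRigidity`) ⟸ PAR ∧ DCD ∧ TPD ∧ SART ∧ IMP₃. -/
theorem closes_rigid (hP : PowerAvatarDescent) (hD : DihedralCandidateDescent) (hT : TwistedPrimitiveDescent)
    (hA : MonomialConverse.StrongArtinAE) (hI : HigherRankImprimitiveRigidity) : PerfectLayerRigidity :=
  PhaseTwistSplit.closes_target hP (closes_target hD hT hA hI)

/-- The live ledger item stmt-Langlands-27355 `Theses.PerfectLayerClifford.PerfectLayerRigidity` BY NAME. -/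
theorem closes_item (hP : PowerAvatarDescent) (hD : DihedralCandidateDescent) (hT : TwistedPrimitiveDescent)
    (hA : MonomialConverse.StrongArtinAE) (hI : HigherRankImprimitiveRigidity) :
    Summit.Langlands.Langlands.Theses.PerfectLayerClifford.PerfectLayerRigidity :=
  PhaseTwistSplit.closes_item hP (closes_target hD hT hA hI)

/-- g29's declared residual AUT `TwinRigiditySplit.CandidateAutomorphy` BY NAME (tree `PhaseTwistSplit.closes_residual`). -/
theorem closes_aut (hP : PowerAvatarDescent) (hD : DihedralCandidateDescent) (hT : TwistedPrimitiveDescent)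
    (hA : MonomialConverse.StrongArtinAE) (hI : HigherRankImprimitiveRigidity) : TwinRigiditySplit.CandidateAutomorphy :=
  PhaseTwistSplit.closes_residual hP (closes_target hD hT hA hI)

/-- With the route's other items EXT (27354), FINTYPE (27356), RED° (27357): the host leaf `GaloisHullLift.PerfectHullDescent` (28225) through the
ROUTE'S OWN deciding theorem (tree `PhaseTwistSplit.closes_route`). -/
theorem closes_route (hE : Summit.Langlands.Langlands.Theses.PerfectLayerClifford.PerfectLayerExtension) (hP : PowerAvatarDescent)
    (hD : DihedralCandidateDescent) (hT : TwistedPrimitiveDescent) (hA : MonomialConverse.StrongArtinAE) (hI : HigherRankImprimitiveRigidity)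
    (hF : Summit.Langlands.Langlands.Theses.PerfectLayerClifford.FiniteTypePerfectDescent)
    (hRed : Summit.Langlands.Langlands.Theses.PerfectLayerClifford.ReduciblePerfectDescent) : GaloisHullLift.PerfectHullDescent :=
  PhaseTwistSplit.closes_route hE hP (closes_target hD hT hA hI) hF hRed

/-! ## §4 The decided algebraic heart of DCD / TPD (kernel-certified; the analytic steps are the print theorems cited in the docstring) -/

section Heart

/-- **The identity cell sees `−1`.**  If the Satake pair `{b₁, b₂}` has trace zero (as it does at a place inert in `M` and split in `L`:
there the relative relation is EXACT and `Ind χ₀` has trace `0` off `Γ_M`) then the adjoint trace `b₁/b₂ + 1 + b₂/b₁` equals `−1` —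
whereas Rankin–Selberg against the Artin forms of `Gal(ML/K) ≅ C₂ × G` forces the mean over that Chebotarev cell to be `0` or `±3` (below). -/
theorem adTrace_of_trace_zero {F : Type*} [Field F] {b₁ b₂ : F} (h : b₁ + b₂ = 0) (h₁ : b₁ ≠ 0) :
    b₁ / b₂ + 1 + b₂ / b₁ = -1 := by
  have h₂ : b₂ = -b₁ := by linear_combination h
  subst h₂
  rw [div_neg, neg_div, div_self h₁]
  ring

/-- The induced shape off the subgroup: an antidiagonal `2 × 2` matrix (the image of `g ∉ Γ_M` under `Ind_{Γ_M}^{Γ_K} χ₀` in the basis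
`e, g·e`) has trace `0` … -/
theorem trace_antidiagonal {F : Type*} [CommRing F] (x y : F) : Matrix.trace !![(0 : F), x; y, 0] = 0 := by
  simp [Matrix.trace_fin_two]

/-- … and determinant `−xy`, so its eigenvalues are `±β` with `β² = xy`: the Satake pair on the cell is `{β, −β}`. -/
theorem det_antidiagonal {F : Type*} [CommRing F] (x y : F) : Matrix.det !![(0 : F), x; y, 0] = -(x * y) := by
  simp [Matrix.det_fin_two]

/-- **The obstruction's arithmetic** (proof (a)).  Column orthogonality at the central class `(c,1)` of `C₂ × G` writes the cell mean of
`Tr ad(t_{π,v})` as `(1/|C₂ × G|) · Σ_B (±1) · dim(A_B) · m_B` with `m_B ∈ {0, 1}` the pole order of `L^S(s, ad π × π_B)` at `s = 1`, non-zero for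
at most ONE `B` (`π_B ≅ ad π`, forcing `dim A_B = 3`); so `|C₂ × G| ·` mean is `0`, `3` or `−3` — never the observed `−1`. -/
theorem cellMean_obstruction (m : ℤ) (hm : m = 0 ∨ m = 3 ∨ m = -3) : m ≠ -1 := by omega

/-- **The isotypic cell has positive mass** (proof (b)): the mean square of a character over a subset containing the identity is positive —
in the minimal form the argument uses: a sum of squares of integers/reals one of which is `3² = 9` is non-zero. -/
theorem isotypicMass_pos {ι : Type*} (s : Finset ι) (f : ι → ℝ) {i : ι} (hi : i ∈ s) (h3 : f i = 3) : 0 < ∑ j ∈ s, f j ^ 2 := by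
  have h9 : (0 : ℝ) < f i ^ 2 := by rw [h3]; norm_num
  exact lt_of_lt_of_le h9 (Finset.single_le_sum (fun j _ => sq_nonneg (f j)) hi)

end Heart

end Summit.Langlands.Langlands.Theorems.AdjointCellSplit
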